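import Summits.ABC.IUTFork.Cor312ThetaSlotLocalLeContentHull
import Summits.ABC.IUTFork.Cor312ThetaSlotLocalGeContentHull
import Summits.ABC.IUTFork.Cor312PilotIdelesPrContentLower
import Summits.ABC.IUTFork.Cor312ThetaFinitePrVol
import HarnessLib

/-!
# [IUTchIII] Corollary 3.12 IN READING (P) at the print-normalised SHARP real setting — the SLOT-HULL local term IS the last-slot orbit-hull sum:
# `−|log(Θ)|^{(P)}_{i+1,p} = Σ_{v⃗} Pr(v⃗)·log μ̄_{v⃗}(hull(Ind2·ι_{i+1}(t_{Θ,i+1,v_{i+1}})·(R_I)^∼))` (ANY base field, ANY Θ-ideles)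

PROOF-ONLY file (D-0012; no definitions, no `Prop` facts) of the abc-iut cell (R2 S-chain team, seat abc-iut-s2-p7 gen 3, CLAIM «HΘP-K»:
the READ-P binder of the branch-C γ certificate; reading-(P) twin of this seat's `Cor312PilotIdelesPrContentBound` p438921 /
`Cor312PilotIdelesPrContentLower` p452341). TAKES NO SIDE on [IUTchIII] Cor. 3.12 or on the reading (U)/(P) of `−|log(Θ)|`.

At abc-iut-c312-7's `Real.settingPrVolSharp X hlog …` (Cor. 3.12's setting over the REAL log-shells of the field `F` of the pilot data `X`, ALL places over
each `p`, packet-normalised volumes `Pr(v⃗)`, SHARP Dupuy–Hilado Θ-boxes `ι_j(t_{Θ,j,v_j})·(R_I)^∼` read off Θ-ideles `t`), abc-iut-C-cert-2's reading-(P)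
quantities (`Cor312SlotHull` p458847: `thetaSlotImages`, `thetaSlotHull`, `thetaSlotLocal`, `negLogThetaSlot`) are COMPUTED:
* §1 `slotHullDefined_settingPrVolSharp` (bounded inside the full union; nondegenerate because the region's image is the hull-set `λ_Θ·𝒪_L`,
  abc-iut-c312-3 `isHullSet_thetaBoxDH_sharp`); `thetaSlotLocal_settingPrVolSharp_inl_eq_zero` (trivial archimedean container);
  `thetaSlotLocal_settingPrVolSharp_eq_zero_of_good` (at `p ∤ 2·disc F` with unit Θ-ideles, reading (P) = reading (U) = `0`: the full hull is the
  unit lattice = the region, abc-iut-c312-7 `thetaHull_settingPrVol_eq_of_good`);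
* §2 **`thetaSlotLocal_settingPrVolSharp_untopD_le_sum_content_hull`** / **`sum_content_hull_le_thetaSlotLocal_settingPrVolSharp_untopD`** — the two
  inequalities of `Cor312ThetaSlotLocalLeContentHull` / `Cor312ThetaSlotLocalGeContentHull` instantiated (`hframe := rfl`, `hvol :=` abc-iut-c312-5
  `SummandPieces.logvol_preimage_pi`, `hism` ⇐ Ism of `Real.logShellsDH` is FULL, abc-iut-s2-p9 p449844, `hwit` ⇐ the region is the product of the
  last-slot boxes) for ANY family `m` bracketing / EXACTLY measuring the LAST-slot boxes; **`thetaSlotLocal_settingPrVolSharp_eq_sum_content_hull`**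
  (EQUALITY) and the hypothesis-free ORBIT form **`thetaSlotLocal_settingPrVolSharp_eq_sum_orbitHull`** — summand by summand Dupuy–Hilado's
  per-slot-image shape (abc-iut-S7 `PrimePacket.slotImagesHull`, abc-iut-s2-p2 `realPrimePacketWith_slotImages_pilotRegion_eq`).

USE (sequel `Cor312ThetaSlotExactK`): at `X := pilotDataOfK D K`, `negLogThetaSlot (settingPrVolSharp …) = ↑I.negLogThetaPerImageNonarch`.
[cite: Mochizuki2012, IUTchIII Thm. 3.11 (i) (Ind2) p. 154; Cor. 3.12 proof Step (x) p. 181] [cite: Mochizuki2012, IUTchIV Thm. 1.10 Steps (v)–(vii)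
p. 27–30] [cite: DupuyHilado2025, §3.7, §3.9, §4.9, §4.11, §4.12] [cite: WeilBNT1967, Ch. II §2, Th. 2] [claim: Mochizuki2012, status: disputed]
for every quoted construction. HONEST FRAMING: identities between OUR typed objects at ONE instantiation (sharp (Ind3) reading, DH-level
factorwise (Ind2), trivial archimedean container); reading (P) is STRONGER than print's hull-of-the-union; nothing here asserts or denies
Cor. 3.12 for any initial Θ-data or takes a side on any author; typed ≠ proved; instantiated ≠ endorsed.
-/

noncomputable section

open Set Function NumberField IsDedekindDomain
open scoped Pointwise

namespace Summit.ABC.IUTFork.Thm311.Real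

open Cor312 Cor312Vol Literature.IUT.LogThetaLattice Literature.IUT.LogVolume

variable {F : Type} [Field F] [NumberField F] (X : PilotData F) {logv : PadicLogs F} (hlog : LogvAnalytic logv)
  (M : Type) [Field M] [NumberField M]
  (archPk : ∀ (j : (thetaIndex X).Label) (vQ : (thetaIndex X).VQ), Set ((logShellsDH X logv).Packet j vQ))
  (archSub : ∀ (j : (thetaIndex X).Label) (v : (thetaIndex X).V),
    Set ((logShellsDH X logv).Packet j ((thetaIndex X).over v)))
  (Ψ : ℤ → ∀ v : (thetaIndex X).V, v ∈ (thetaIndex X).Vbad → Set ((logShellsDH X logv).StarPacket v))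
  (act : ℤ → ∀ v : (thetaIndex X).V, v ∈ (thetaIndex X).Vbad →
    (logShellsDH X logv).StarPacket v → Module.End ℚ ((logShellsDH X logv).StarPacket v))
  (Mmod : ℤ → ∀ j : (thetaIndex X).LabelStar, Set ((logShellsDH X logv).GlobalPacket j.1))
  (region : ℤ → ∀ j : (thetaIndex X).LabelStar, FinDivisor M → ∀ vQ : (thetaIndex X).VQ,
    Set ((logShellsDH X logv).Packet j.1 vQ))
  (n : ℤ) {HT : Type} {LogLink : HT → HT → Type} {IsFull : ∀ {s t : HT}, LogLink s t → Prop}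
  (lat : LGPGaussianLogThetaLattice LogLink IsFull)
  {Frd : Type} {IsoF : Frd → Frd → Type} {Ob : Frd → Type} {realify : Frd → Frd} {Strip : Type}
  {IsoS : Strip → Strip → Type} {Mv : ∀ v : (thetaIndex X).V, v ∈ (thetaIndex X).Vbad → Type}
  [∀ v h, Monoid (Mv v h)]
  (sig : GlobalLGPFrobenioidSignature (thetaIndex X).lstar (thetaIndex X).V (· ∈ (thetaIndex X).Vbad)
    Frd IsoF Ob realify Strip IsoS Mv)
  (split : SplittingMonoids Mv) {ObΔ : Type} {N : ∀ v : (thetaIndex X).V, v ∈ (thetaIndex X).Vbad → Type}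
  [∀ v h, Monoid (N v h)] (qData : QPilotData ObΔ N)
  (t : ∀ (pp : Nat.Primes) (_ : Fin X.lstar) (x : (thetaIndex X).Fibre (.inr pp)),
    haveI : Fact (pp : ℕ).Prime := ⟨pp.2⟩; kOf X pp.1 x)
  (tq : ∀ (pp : Nat.Primes) (x : (thetaIndex X).Fibre (.inr pp)), haveI : Fact (pp : ℕ).Prime := ⟨pp.2⟩; kOf X pp.1 x)
  (htq0 : ∀ pp x, tq pp x ≠ 0)
  (htq1 : ∀ (pp : Nat.Primes) (x : (thetaIndex X).Fibre (.inr pp)),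
    haveI : Fact (pp : ℕ).Prime := ⟨pp.2⟩; placeOf X pp.1 x ∉ X.S → ‖tq pp x‖ = 1)

/-! ## §1. `SlotHullDefined` everywhere; the slot term vanishes at `∞` and at the primes of good reduction -/

/-- **`SlotHullDefined` at `v_ℚ = ∞`, UNCONDITIONALLY** (empty field-factor index: the trivial archimedean container, as for abc-iut-c312-7's
`hullDefined_settingPrVol_inl`). [claim: Mochizuki2012, status: disputed] -/
theorem slotHullDefined_settingPrVolSharp_inl (j : (thetaIndex X).Label) (u : Unit) :
    (settingPrVolSharp X hlog M archPk archSub Ψ act Mmod region n lat sig split qData tq t htq0 htq1).SlotHullDefined j (.inl u) := by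
  refine ⟨isBounded_iff_forall_norm_le.2 ⟨0, fun z _ => (pi_norm_le_iff_of_nonneg le_rfl).2 fun s => s.elim⟩, fun s => s.elim⟩

/-- **`SlotHullDefined` at `v_ℚ = p`** for non-zero Θ-ideles (units off `S`): the slot union is relatively compact (inside the full union) and
nondegenerate (it contains the (Ind3)-region, whose image is the hull-set `λ_Θ·𝒪_L`, abc-iut-c312-3 `isHullSet_thetaBoxDH_sharp`).
[cite: Mochizuki2012, IUTchIII Rmk. 3.9.5 (i) p. 127] [cite: DupuyHilado2025, §3.9, §4.11] -/
theorem slotHullDefined_settingPrVolSharp_inr (ht0 : ∀ pp i x, t pp i x ≠ 0)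
    (ht1 : ∀ (pp : Nat.Primes) (i : Fin X.lstar) (x : (thetaIndex X).Fibre (.inr pp)),
      haveI : Fact (pp : ℕ).Prime := ⟨pp.2⟩; placeOf X pp.1 x ∉ X.S → ‖t pp i x‖ = 1)
    (i : Fin (thetaIndex X).lstar) (pp : Nat.Primes) :
    (settingPrVolSharp X hlog M archPk archSub Ψ act Mmod region n lat sig split qData tq t htq0 htq1).SlotHullDefined
      (Setting.labelSucc i) (.inr pp) := by
  haveI : Fact (pp : ℕ).Prime := ⟨pp.2⟩
  refine (settingPrVolSharp X hlog M archPk archSub Ψ act Mmod region n lat sig split qData tq t htq0 htq1).slotHullDefined_of_hullDefined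
    (hullDefined_of_finite (bridgeHyps_settingPrVolSharp_of_ideles X hlog M archPk archSub Ψ act Mmod region n lat sig split qData
      t tq ht0 ht1 htq0 htq1) i _) ?_
  -- nondegenerate: the image of the region is the hull-set `λ_Θ·𝒪_L`, and the slot union contains the region
  have hnd : IsNondegenerate (factorFieldDH X hlog (Setting.labelSucc i) (.inr pp)) (factorMapDH X hlog (Setting.labelSucc i) (.inr pp) ''
      (settingPrVolSharp X hlog M archPk archSub Ψ act Mmod region n lat sig split qData tq t htq0 htq1).thetaRegion3
        (Setting.labelSucc i) (.inr pp)) := by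
    change IsNondegenerate (factorFieldDH X hlog (Setting.labelSucc i) (.inr pp)) (factorMapDH X hlog (Setting.labelSucc i) (.inr pp) ''
      (settingPrVol X hlog M archPk archSub Ψ act Mmod region n lat sig split qData
        (fun _ _ => thetaBoxDH X hlog (sharpBoxDH X hlog t)) (fun _ => qCentreDH X hlog tq) (qCentreDH_ne_zero X hlog tq htq0)
        (finite_support_logvol_qRegion_Pr X hlog M archPk archSub Ψ act Mmod region n tq htq0 htq1)).thetaRegion3
          (Setting.labelSucc i) (.inr pp))
    rw [image_thetaRegion3_settingPrVol_inr, iUnion_thetaBoxDH_sharp]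
    exact (isHullSet_thetaBoxDH_sharp X hlog t ht0 (Setting.labelSucc i) (.inr pp)).isNondegenerate
  change IsNondegenerate (factorFieldDH X hlog (Setting.labelSucc i) (.inr pp)) (factorMapDH X hlog (Setting.labelSucc i) (.inr pp) ''
    ⋃₀ (settingPrVolSharp X hlog M archPk archSub Ψ act Mmod region n lat sig split qData tq t htq0 htq1).thetaSlotImages
      (Setting.labelSucc i) (.inr pp))
  intro s
  obtain ⟨u, hu, hus⟩ := hnd s
  exact ⟨u, Set.image_mono (Set.subset_sUnion_of_mem ((settingPrVolSharp X hlog M archPk archSub Ψ act Mmod region n lat sig split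
    qData tq t htq0 htq1).thetaRegion3_mem_thetaSlotImages (Setting.labelSucc i) (.inr pp))) hu, hus⟩

/-- **`SlotHullDefined` at every `(j, v_ℚ)`, `j ∈ 𝔽_l^⋇`**, for non-zero Θ-ideles (units off `S`). [folklore] -/
theorem slotHullDefined_settingPrVolSharp (ht0 : ∀ pp i x, t pp i x ≠ 0)
    (ht1 : ∀ (pp : Nat.Primes) (i : Fin X.lstar) (x : (thetaIndex X).Fibre (.inr pp)),
      haveI : Fact (pp : ℕ).Prime := ⟨pp.2⟩; placeOf X pp.1 x ∉ X.S → ‖t pp i x‖ = 1)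
    (i : Fin (thetaIndex X).lstar) :
    ∀ vQ : (thetaIndex X).VQ,
      (settingPrVolSharp X hlog M archPk archSub Ψ act Mmod region n lat sig split qData tq t htq0 htq1).SlotHullDefined
        (Setting.labelSucc i) vQ
  | .inl u => slotHullDefined_settingPrVolSharp_inl X hlog M archPk archSub Ψ act Mmod region n lat sig split qData t tq htq0 htq1 _ u
  | .inr pp => slotHullDefined_settingPrVolSharp_inr X hlog M archPk archSub Ψ act Mmod region n lat sig split qData t tq htq0 htq1
      ht0 ht1 i pp

/-- **The slot term vanishes at `v_ℚ = ∞`** (every region has log-volume `0` there, abc-iut-c312-7 `logvol_situationPrVol_inl`). [folklore] -/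
theorem thetaSlotLocal_settingPrVolSharp_inl_eq_zero (j : (thetaIndex X).Label) (u : Unit) :
    (settingPrVolSharp X hlog M archPk archSub Ψ act Mmod region n lat sig split qData tq t htq0 htq1).thetaSlotLocal j (.inl u) =
      ((0 : ℝ) : WithTop ℝ) := by
  rw [(settingPrVolSharp X hlog M archPk archSub Ψ act Mmod region n lat sig split qData tq t htq0 htq1).thetaSlotLocal_eq_coe
    (slotHullDefined_settingPrVolSharp_inl X hlog M archPk archSub Ψ act Mmod region n lat sig split qData t tq htq0 htq1 j u)]
  exact congrArg _ (logvol_situationPrVol_inl X hlog M archPk archSub Ψ act Mmod region n u j _)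

/-- **At a prime of good reduction the slot term IS the full term, `= 0`**: if `p ∤ 2·disc F` (`hp2`, `hdisc`) and the sharp Θ-box at `(i+1, p)` is
the unit polydisc (`hbox`), the full hull is the unit lattice (abc-iut-c312-7 `thetaHull_settingPrVol_eq_of_good`) = the (Ind3)-region
(`preimage_factorMapDH_hullSet_one`, `latticePk_one_eq_of_unramified`), so reading (P) = reading (U) there and both vanish (abc-iut-c312-7
`thetaLocal_settingPrVol_eq_zero`; [IUTchIV] Thm. 1.10 Step (vi)). [cite: Mochizuki2012, IUTchIV Thm. 1.10 Step (vi) p. 29] [cite: DupuyHilado2025, §3.9] -/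
theorem thetaSlotLocal_settingPrVolSharp_eq_zero_of_good (i : Fin (thetaIndex X).lstar) (pp : Nat.Primes)
    (hp2 : 2 < (pp : ℕ)) (hdisc : ¬ ((pp : ℕ) : ℤ) ∣ NumberField.discr F)
    (hbox : thetaBoxDH X hlog (sharpBoxDH X hlog t) (Setting.labelSucc i) (.inr pp) =
      hullSet (factorFieldDH X hlog (Setting.labelSucc i) (.inr pp)) (fun _ => 1)) :
    (settingPrVolSharp X hlog M archPk archSub Ψ act Mmod region n lat sig split qData tq t htq0 htq1).thetaSlotLocal
        (Setting.labelSucc i) (.inr pp) = ((0 : ℝ) : WithTop ℝ) := by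
  haveI : Fact (pp : ℕ).Prime := ⟨pp.2⟩
  have hbox' : (⋃ _m : ℤ, thetaBoxDH X hlog (sharpBoxDH X hlog t) (Setting.labelSucc i) (.inr pp)) =
      hullSet (factorFieldDH X hlog (Setting.labelSucc i) (.inr pp)) (fun _ => 1) := by
    rw [iUnion_thetaBoxDH_sharp, hbox]
  -- the full hull is the unit lattice …
  have hU := thetaHull_settingPrVol_eq_of_good X hlog M archPk archSub Ψ act Mmod region n lat sig split qData
    (fun _ _ => thetaBoxDH X hlog (sharpBoxDH X hlog t)) (fun _ => qCentreDH X hlog tq) (qCentreDH_ne_zero X hlog tq htq0)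
    (finite_support_logvol_qRegion_Pr X hlog M archPk archSub Ψ act Mmod region n tq htq0 htq1) i pp hp2 hdisc hbox'
  -- … which is the (Ind3)-region
  have h3 : (settingPrVolSharp X hlog M archPk archSub Ψ act Mmod region n lat sig split qData tq t htq0 htq1).thetaRegion3
      (Setting.labelSucc i) (.inr pp) = (presAt X hlog pp).latticePk (Setting.labelSucc i) 1 := by
    show (settingPrVol X hlog M archPk archSub Ψ act Mmod region n lat sig split qData
      (fun _ _ => thetaBoxDH X hlog (sharpBoxDH X hlog t)) (fun _ => qCentreDH X hlog tq) (qCentreDH_ne_zero X hlog tq htq0)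
      (finite_support_logvol_qRegion_Pr X hlog M archPk archSub Ψ act Mmod region n tq htq0 htq1)).thetaRegion3
        (Setting.labelSucc i) (.inr pp) = _
    rw [thetaRegion3_settingPrVol, hbox']
    exact (preimage_factorMapDH_hullSet_one X hlog _ pp).trans
      ((presAt X hlog pp).latticePk_one_eq_of_unramified hp2 (two_le_card_caps_labelSucc X i)
        (absRamificationIdx_presAt_eq_one X hlog pp hdisc)).symm
  rw [(settingPrVolSharp X hlog M archPk archSub Ψ act Mmod region n lat sig split qData tq t htq0 htq1).thetaSlotLocal_eq_thetaLocal_of_thetaHull_subset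
    (by rw [h3]; exact hU.le)]
  exact thetaLocal_settingPrVol_eq_zero X hlog M archPk archSub Ψ act Mmod region n lat sig split qData
    (fun _ _ => thetaBoxDH X hlog (sharpBoxDH X hlog t)) (fun _ => qCentreDH X hlog tq) (qCentreDH_ne_zero X hlog tq htq0)
    (finite_support_logvol_qRegion_Pr X hlog M archPk archSub Ψ act Mmod region n tq htq0 htq1) i pp hp2 hdisc hbox'

/-- The same at a prime `p ∤ 2·disc F` where the Θ-ideles of the label are units (`thetaBoxDH_sharp_eq_hullSet_one`). [cite: DupuyHilado2025, §3.9] -/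
theorem thetaSlotLocal_settingPrVolSharp_eq_zero_of_norm_eq_one (ht0 : ∀ pp i x, t pp i x ≠ 0) (i : Fin (thetaIndex X).lstar)
    (pp : Nat.Primes) (hp2 : 2 < (pp : ℕ)) (hdisc : ¬ ((pp : ℕ) : ℤ) ∣ NumberField.discr F)
    (h1 : ∀ x : (thetaIndex X).Fibre (.inr pp), haveI : Fact (pp : ℕ).Prime := ⟨pp.2⟩; ‖t pp i x‖ = 1) :
    (settingPrVolSharp X hlog M archPk archSub Ψ act Mmod region n lat sig split qData tq t htq0 htq1).thetaSlotLocal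
        (Setting.labelSucc i) (.inr pp) = ((0 : ℝ) : WithTop ℝ) :=
  thetaSlotLocal_settingPrVolSharp_eq_zero_of_good X hlog M archPk archSub Ψ act Mmod region n lat sig split qData t tq htq0 htq1 i pp
    hp2 hdisc (thetaBoxDH_sharp_eq_hullSet_one X hlog t ht0 i pp h1)

/-! ## §2. The two inequalities, the EQUALITY at the exact last-slot content family, and the orbit-hull form -/

/-- **`(−|log(Θ)|^{(P)}_{i+1,p}).untopD 0 ≤ Σ_{v⃗} Pr(v⃗)·(−m(v⃗)·log p + log μ̄_{v⃗}(hull(log_p(R_{v⃗}^×))))`** at `settingPrVolSharp` for ANY family `m`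
bracketing the LAST-slot boxes (`hm0`; NO capsule symmetry, NO condition on the other slots): `Cor312Vol.thetaSlotLocal_untopD_le_sum_content_hull`
with `hframe := rfl`, `hvol :=` abc-iut-c312-5 `SummandPieces.logvol_preimage_pi`, `hmono` from abc-iut-c312-7's `BridgeHyps`, region = product of the
last-slot boxes. [cite: Mochizuki2012, IUTchIV Thm. 1.10 Step (v) p. 27–28] [cite: DupuyHilado2025, §3.9, §4.12] -/
theorem thetaSlotLocal_settingPrVolSharp_untopD_le_sum_content_hull (ht0 : ∀ pp i x, t pp i x ≠ 0)
    (ht1 : ∀ (pp : Nat.Primes) (i : Fin X.lstar) (x : (thetaIndex X).Fibre (.inr pp)),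
      haveI : Fact (pp : ℕ).Prime := ⟨pp.2⟩; placeOf X pp.1 x ∉ X.S → ‖t pp i x‖ = 1)
    (i : Fin (thetaIndex X).lstar) (pp : Nat.Primes)
    (m : ((thetaIndex X).Caps (Setting.labelSucc i) → (thetaIndex X).Fibre (.inr pp)) → ℤ)
    (hm0 : ∀ e : (thetaIndex X).Caps (Setting.labelSucc i) → (thetaIndex X).Fibre (.inr pp),
      haveI : Fact (pp : ℕ).Prime := ⟨pp.2⟩
      iota pp.1 ((presAt X hlog pp).kk e) (Fin.last _) (t pp i (e (Fin.last _))) •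
          (normalizedPacket pp.1 ((presAt X hlog pp).kk e) : Set ((presAt X hlog pp).X e)) ⊆
        (((pp : ℕ) : ℚ_[pp]) ^ m e) • (logPacket pp.1 ((presAt X hlog pp).kk e) : Set ((presAt X hlog pp).X e))) :
    haveI : Fact (pp : ℕ).Prime := ⟨pp.2⟩
    ((settingPrVolSharp X hlog M archPk archSub Ψ act Mmod region n lat sig split qData tq t htq0 htq1).thetaSlotLocal
        (Setting.labelSucc i) (.inr pp)).untopD 0 ≤
      ∑ e : (presAt X hlog pp).toLocalPieces.E (Setting.labelSucc i),
        weightPr X pp.1 (Setting.labelSucc i) e * (-(m e * Real.log pp) +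
          packetLogμ pp.1 ((presAt X hlog pp).kk e)
            (packetHull pp.1 ((presAt X hlog pp).kk e)
              (logPacket pp.1 ((presAt X hlog pp).kk e) : Set ((presAt X hlog pp).X e)))) := by
  haveI : Fact (pp : ℕ).Prime := ⟨pp.2⟩
  letI : Fintype ((thetaIndex X).Caps (Setting.labelSucc i) → (thetaIndex X).Fibre (.inr pp)) := Fintype.ofFinite _
  letI : Fintype ((presAtPr X hlog pp).factorIdx (Setting.labelSucc i)) :=
    factorIdxDH_fintype X hlog (Setting.labelSucc i) (.inr pp)
  have H := bridgeHyps_settingPrVolSharp_of_ideles X hlog M archPk archSub Ψ act Mmod region n lat sig split qData t tq ht0 ht1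
    htq0 htq1
  have hframe : (settingPrVolSharp X hlog M archPk archSub Ψ act Mmod region n lat sig split qData tq t htq0 htq1).frame
      (Setting.labelSucc i) (.inr pp) =
      HullFrame.ofComparison ((presAtPr X hlog pp).factorField (Setting.labelSucc i))
        (fun x => (presAtPr X hlog pp).factorMap (Setting.labelSucc i) x) := rfl
  have hvol : ∀ R : ∀ e : (thetaIndex X).Caps (Setting.labelSucc i) → (thetaIndex X).Fibre (.inr pp),
      Set ((presAtPr X hlog pp).X e),
      (∀ e, PacketAdm pp.1 ((presAtPr X hlog pp).kk e) (R e)) →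
        ((situationPrVol X hlog M archPk archSub Ψ act Mmod region).D n).logvol (Setting.labelSucc i) (.inr pp)
          ((presAtPr X hlog pp).comparison (Setting.labelSucc i) ⁻¹' Set.pi univ R) =
        ∑ e, (presAtPr X hlog pp).w (Setting.labelSucc i) e * packetLogμ pp.1 ((presAtPr X hlog pp).kk e) (R e) :=
    fun R hR => ((realizes_situationPrVol X hlog M archPk archSub Ψ act Mmod region n).logvol_eq _ (.inr pp) _).trans
      (SummandPieces.logvol_preimage_pi (summandPiecesPr X hlog) _ (.inr pp) hR)
  have h3 : (settingPrVolSharp X hlog M archPk archSub Ψ act Mmod region n lat sig split qData tq t htq0 htq1).thetaRegion3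
      (Setting.labelSucc i) (.inr pp) ⊆ (presAtPr X hlog pp).comparison (Setting.labelSucc i) ⁻¹' Set.pi univ fun e =>
        (((pp : ℕ) : ℚ_[pp]) ^ m e) • (logPacket pp.1 ((presAtPr X hlog pp).kk e) : Set ((presAtPr X hlog pp).X e)) := by
    rw [thetaRegion3_settingPrVolSharp_eq_preimage_pi_sharpBox X hlog M archPk archSub Ψ act Mmod region n lat sig split qData t tq htq0
      htq1 (Setting.labelSucc i) pp]
    refine Set.preimage_mono (Set.pi_mono fun e _ => ?_)
    rw [PadicPresentation.sharpBox, PadicPresentation.labelIdele_labelSucc]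
    exact hm0 e
  exact @thetaSlotLocal_untopD_le_sum_content_hull (thetaIndex X) (situationPrVol X hlog M archPk archSub Ψ act Mmod region)
    (settingPrVolSharp X hlog M archPk archSub Ψ act Mmod region n lat sig split qData tq t htq0 htq1) (.inr pp) pp.1 ⟨pp.2⟩
    (presAtPr X hlog pp) H.mono i _ _
    (slotHullDefined_settingPrVolSharp_inr X hlog M archPk archSub Ψ act Mmod region n lat sig split qData t tq htq0 htq1 ht0 ht1 i pp)
    hframe hvol m h3

/-- The `WithTop` form of the upper bound. [cite: Mochizuki2012, IUTchIV Thm. 1.10 Step (v) p. 27–28] -/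
theorem thetaSlotLocal_settingPrVolSharp_le_sum_content_hull (ht0 : ∀ pp i x, t pp i x ≠ 0)
    (ht1 : ∀ (pp : Nat.Primes) (i : Fin X.lstar) (x : (thetaIndex X).Fibre (.inr pp)),
      haveI : Fact (pp : ℕ).Prime := ⟨pp.2⟩; placeOf X pp.1 x ∉ X.S → ‖t pp i x‖ = 1)
    (i : Fin (thetaIndex X).lstar) (pp : Nat.Primes)
    (m : ((thetaIndex X).Caps (Setting.labelSucc i) → (thetaIndex X).Fibre (.inr pp)) → ℤ)
    (hm0 : ∀ e : (thetaIndex X).Caps (Setting.labelSucc i) → (thetaIndex X).Fibre (.inr pp),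
      haveI : Fact (pp : ℕ).Prime := ⟨pp.2⟩
      iota pp.1 ((presAt X hlog pp).kk e) (Fin.last _) (t pp i (e (Fin.last _))) •
          (normalizedPacket pp.1 ((presAt X hlog pp).kk e) : Set ((presAt X hlog pp).X e)) ⊆
        (((pp : ℕ) : ℚ_[pp]) ^ m e) • (logPacket pp.1 ((presAt X hlog pp).kk e) : Set ((presAt X hlog pp).X e))) :
    haveI : Fact (pp : ℕ).Prime := ⟨pp.2⟩
    (settingPrVolSharp X hlog M archPk archSub Ψ act Mmod region n lat sig split qData tq t htq0 htq1).thetaSlotLocal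
        (Setting.labelSucc i) (.inr pp) ≤
      ((∑ e : (presAt X hlog pp).toLocalPieces.E (Setting.labelSucc i),
          weightPr X pp.1 (Setting.labelSucc i) e * (-(m e * Real.log pp) +
            packetLogμ pp.1 ((presAt X hlog pp).kk e)
              (packetHull pp.1 ((presAt X hlog pp).kk e)
                (logPacket pp.1 ((presAt X hlog pp).kk e) : Set ((presAt X hlog pp).X e)))) : ℝ) : WithTop ℝ) := by
  haveI : Fact (pp : ℕ).Prime := ⟨pp.2⟩
  exact (settingPrVolSharp X hlog M archPk archSub Ψ act Mmod region n lat sig split qData tq t htq0 htq1).thetaSlotLocal_le_coe_of_untopD_le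
    (slotHullDefined_settingPrVolSharp_inr X hlog M archPk archSub Ψ act Mmod region n lat sig split qData t tq htq0 htq1 ht0 ht1 i pp)
    (thetaSlotLocal_settingPrVolSharp_untopD_le_sum_content_hull X hlog M archPk archSub Ψ act Mmod region n lat sig split qData t tq
      htq0 htq1 ht0 ht1 i pp m hm0)

/-- **`Σ_{v⃗} Pr(v⃗)·(−m(v⃗)·log p + log μ̄_{v⃗}(hull(log_p(R_{v⃗}^×)))) ≤ (−|log(Θ)|^{(P)}_{i+1,p}).untopD 0`** at `settingPrVolSharp` for the EXACT content
family `m` of the LAST-slot boxes (`hm0`/`hm1`): `Cor312Vol.sum_content_hull_le_thetaSlotLocal_untopD` with `hism` from the FULLNESS of Ism (abc-iut-s2-p9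
p449844, through `exists_ind2Family_comparison_eq_congr`) and `hwit` from the product of the last-slot boxes. [cite: Mochizuki2012, IUTchIII
Thm. 3.11 (i) (Ind2) p. 154; Cor. 3.12 proof Step (x) p. 181] [cite: DupuyHilado2025, §4.9, §4.12] -/
theorem sum_content_hull_le_thetaSlotLocal_settingPrVolSharp_untopD (ht0 : ∀ pp i x, t pp i x ≠ 0)
    (ht1 : ∀ (pp : Nat.Primes) (i : Fin X.lstar) (x : (thetaIndex X).Fibre (.inr pp)),
      haveI : Fact (pp : ℕ).Prime := ⟨pp.2⟩; placeOf X pp.1 x ∉ X.S → ‖t pp i x‖ = 1)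
    (i : Fin (thetaIndex X).lstar) (pp : Nat.Primes)
    (m : ((thetaIndex X).Caps (Setting.labelSucc i) → (thetaIndex X).Fibre (.inr pp)) → ℤ)
    (hm0 : ∀ e : (thetaIndex X).Caps (Setting.labelSucc i) → (thetaIndex X).Fibre (.inr pp),
      haveI : Fact (pp : ℕ).Prime := ⟨pp.2⟩
      iota pp.1 ((presAt X hlog pp).kk e) (Fin.last _) (t pp i (e (Fin.last _))) •
          (normalizedPacket pp.1 ((presAt X hlog pp).kk e) : Set ((presAt X hlog pp).X e)) ⊆
        (((pp : ℕ) : ℚ_[pp]) ^ m e) • (logPacket pp.1 ((presAt X hlog pp).kk e) : Set ((presAt X hlog pp).X e)))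
    (hm1 : ∀ e : (thetaIndex X).Caps (Setting.labelSucc i) → (thetaIndex X).Fibre (.inr pp),
      haveI : Fact (pp : ℕ).Prime := ⟨pp.2⟩
      ¬ iota pp.1 ((presAt X hlog pp).kk e) (Fin.last _) (t pp i (e (Fin.last _))) •
          (normalizedPacket pp.1 ((presAt X hlog pp).kk e) : Set ((presAt X hlog pp).X e)) ⊆
        (((pp : ℕ) : ℚ_[pp]) ^ (m e + 1)) • (logPacket pp.1 ((presAt X hlog pp).kk e) : Set ((presAt X hlog pp).X e))) :
    haveI : Fact (pp : ℕ).Prime := ⟨pp.2⟩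
    ∑ e : (presAt X hlog pp).toLocalPieces.E (Setting.labelSucc i),
        weightPr X pp.1 (Setting.labelSucc i) e * (-(m e * Real.log pp) +
          packetLogμ pp.1 ((presAt X hlog pp).kk e)
            (packetHull pp.1 ((presAt X hlog pp).kk e)
              (logPacket pp.1 ((presAt X hlog pp).kk e) : Set ((presAt X hlog pp).X e)))) ≤
      ((settingPrVolSharp X hlog M archPk archSub Ψ act Mmod region n lat sig split qData tq t htq0 htq1).thetaSlotLocal
        (Setting.labelSucc i) (.inr pp)).untopD 0 := by
  haveI : Fact (pp : ℕ).Prime := ⟨pp.2⟩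
  letI : Fintype ((thetaIndex X).Caps (Setting.labelSucc i) → (thetaIndex X).Fibre (.inr pp)) := Fintype.ofFinite _
  letI : Fintype ((presAtPr X hlog pp).factorIdx (Setting.labelSucc i)) :=
    factorIdxDH_fintype X hlog (Setting.labelSucc i) (.inr pp)
  have hframe : (settingPrVolSharp X hlog M archPk archSub Ψ act Mmod region n lat sig split qData tq t htq0 htq1).frame
      (Setting.labelSucc i) (.inr pp) =
      HullFrame.ofComparison ((presAtPr X hlog pp).factorField (Setting.labelSucc i))
        (fun x => (presAtPr X hlog pp).factorMap (Setting.labelSucc i) x) := rfl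
  have hvol : ∀ R : ∀ e : (thetaIndex X).Caps (Setting.labelSucc i) → (thetaIndex X).Fibre (.inr pp),
      Set ((presAtPr X hlog pp).X e),
      (∀ e, PacketAdm pp.1 ((presAtPr X hlog pp).kk e) (R e)) →
        ((situationPrVol X hlog M archPk archSub Ψ act Mmod region).D n).logvol (Setting.labelSucc i) (.inr pp)
          ((presAtPr X hlog pp).comparison (Setting.labelSucc i) ⁻¹' Set.pi univ R) =
        ∑ e, (presAtPr X hlog pp).w (Setting.labelSucc i) e * packetLogμ pp.1 ((presAtPr X hlog pp).kk e) (R e) :=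
    fun R hR => ((realizes_situationPrVol X hlog M archPk archSub Ψ act Mmod region n).logvol_eq _ (.inr pp) _).trans
      (SummandPieces.logvol_preimage_pi (summandPiecesPr X hlog) _ (.inr pp) hR)
  exact @sum_content_hull_le_thetaSlotLocal_untopD (thetaIndex X) (situationPrVol X hlog M archPk archSub Ψ act Mmod region)
    (settingPrVolSharp X hlog M archPk archSub Ψ act Mmod region n lat sig split qData tq t htq0 htq1) (.inr pp) pp.1 ⟨pp.2⟩
    (presAtPr X hlog pp) i _ _
    (slotHullDefined_settingPrVolSharp_inr X hlog M archPk archSub Ψ act Mmod region n lat sig split qData t tq htq0 htq1 ht0 ht1 i pp)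
    hframe hvol m
    (fun e => exists_mem_thetaRegion3_exact_content_of_sharpBox
      (P := settingPrVolSharp X hlog M archPk archSub Ψ act Mmod region n lat sig split qData tq t htq0 htq1)
      (presAtPr X hlog pp) (t pp) i
      (thetaRegion3_settingPrVolSharp_eq_preimage_pi_sharpBox X hlog M archPk archSub Ψ act Mmod region n lat sig split qData t tq htq0 htq1
        (Setting.labelSucc i) pp) e (m e) (hm0 e) (hm1 e))
    (fun e g' hg' => exists_ind2Family_comparison_eq_congr (S := situationPrVol X hlog M archPk archSub Ψ act Mmod region)
      (presAtPr X hlog pp) (Setting.labelSucc i)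
      (fun v g'' hg'' => exists_ismDH_presAt_of_image_logUnits_eq X pp.1 logv (hlog pp) v g'' hg'') e g' hg')

/-- **THE LOCAL SLOT TERM IS PINNED: `−|log(Θ)|^{(P)}_{i+1,p} = ↑(Σ_{v⃗} Pr(v⃗)·(−m(v⃗)·log p + log μ̄_{v⃗}(hull(log_p(R_{v⃗}^×)))))`** at `settingPrVolSharp` for
the EXACT content family `m` of the LAST-slot boxes (EVERY pilot data, every non-zero Θ-ideles / `q`-ideles, units off `S`) — the two inequalities
above; reading-(P) twin of p452341's `thetaLocal_settingPrVolSharp_eq_sum_content_hull` (there: the slot UNION). [cite: Mochizuki2012, IUTchIII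
Cor. 3.12 proof Step (x) p. 181] [cite: Mochizuki2012, IUTchIV Thm. 1.10 Step (v) p. 27–28] [cite: DupuyHilado2025, §4.9, §4.12] -/
theorem thetaSlotLocal_settingPrVolSharp_eq_sum_content_hull (ht0 : ∀ pp i x, t pp i x ≠ 0)
    (ht1 : ∀ (pp : Nat.Primes) (i : Fin X.lstar) (x : (thetaIndex X).Fibre (.inr pp)),
      haveI : Fact (pp : ℕ).Prime := ⟨pp.2⟩; placeOf X pp.1 x ∉ X.S → ‖t pp i x‖ = 1)
    (i : Fin (thetaIndex X).lstar) (pp : Nat.Primes)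
    (m : ((thetaIndex X).Caps (Setting.labelSucc i) → (thetaIndex X).Fibre (.inr pp)) → ℤ)
    (hm0 : ∀ e : (thetaIndex X).Caps (Setting.labelSucc i) → (thetaIndex X).Fibre (.inr pp),
      haveI : Fact (pp : ℕ).Prime := ⟨pp.2⟩
      iota pp.1 ((presAt X hlog pp).kk e) (Fin.last _) (t pp i (e (Fin.last _))) •
          (normalizedPacket pp.1 ((presAt X hlog pp).kk e) : Set ((presAt X hlog pp).X e)) ⊆
        (((pp : ℕ) : ℚ_[pp]) ^ m e) • (logPacket pp.1 ((presAt X hlog pp).kk e) : Set ((presAt X hlog pp).X e)))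
    (hm1 : ∀ e : (thetaIndex X).Caps (Setting.labelSucc i) → (thetaIndex X).Fibre (.inr pp),
      haveI : Fact (pp : ℕ).Prime := ⟨pp.2⟩
      ¬ iota pp.1 ((presAt X hlog pp).kk e) (Fin.last _) (t pp i (e (Fin.last _))) •
          (normalizedPacket pp.1 ((presAt X hlog pp).kk e) : Set ((presAt X hlog pp).X e)) ⊆
        (((pp : ℕ) : ℚ_[pp]) ^ (m e + 1)) • (logPacket pp.1 ((presAt X hlog pp).kk e) : Set ((presAt X hlog pp).X e))) :
    haveI : Fact (pp : ℕ).Prime := ⟨pp.2⟩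
    (settingPrVolSharp X hlog M archPk archSub Ψ act Mmod region n lat sig split qData tq t htq0 htq1).thetaSlotLocal
        (Setting.labelSucc i) (.inr pp) =
      ((∑ e : (presAt X hlog pp).toLocalPieces.E (Setting.labelSucc i),
          weightPr X pp.1 (Setting.labelSucc i) e * (-(m e * Real.log pp) +
            packetLogμ pp.1 ((presAt X hlog pp).kk e)
              (packetHull pp.1 ((presAt X hlog pp).kk e)
                (logPacket pp.1 ((presAt X hlog pp).kk e) : Set ((presAt X hlog pp).X e)))) : ℝ) : WithTop ℝ) := by
  haveI : Fact (pp : ℕ).Prime := ⟨pp.2⟩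
  have hdef := slotHullDefined_settingPrVolSharp_inr X hlog M archPk archSub Ψ act Mmod region n lat sig split qData t tq htq0 htq1 ht0
    ht1 i pp
  exact le_antisymm
    (thetaSlotLocal_settingPrVolSharp_le_sum_content_hull X hlog M archPk archSub Ψ act Mmod region n lat sig split qData t tq htq0 htq1
      ht0 ht1 i pp m hm0)
    ((settingPrVolSharp X hlog M archPk archSub Ψ act Mmod region n lat sig split qData tq t htq0 htq1).coe_le_thetaSlotLocal_of_le_untopD
      hdef (sum_content_hull_le_thetaSlotLocal_settingPrVolSharp_untopD X hlog M archPk archSub Ψ act Mmod region n lat sig split qData t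
        tq htq0 htq1 ht0 ht1 i pp m hm0 hm1))

/-- **THE ORBIT-HULL FORM, HYPOTHESIS-FREE: `−|log(Θ)|^{(P)}_{i+1,p} = ↑(Σ_{v⃗} Pr(v⃗)·log μ̄_{v⃗}(hull(⋃_{g∈Ind2} g·ι_{i+1}(t_{Θ,i+1,v_{i+1}})·(R_I)^∼)))`**
at `settingPrVolSharp` (EVERY pilot data, every non-zero Θ-ideles / `q`-ideles, units off `S`): the last-slot box contains the non-zero `ι_{i+1}(t)` and is
`ψ`-bounded, so it HAS an exact content `m` (abc-iut-c312-3 `exists_content`); the orbit hull of a region of exact content `m` is `hull(p^m·log_p(R_I^×))`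
(abc-iut-w5-d180 `packetHull_orbit_eq_zpow`). Summand by summand this is Dupuy–Hilado's PER-SLOT-IMAGE shape (abc-iut-S7 `PrimePacket.slotImagesHull`,
abc-iut-s2-p2 `realPrimePacketWith_slotImages_pilotRegion_eq`): print's factorwise (Ind2) and the full lattice group give the SAME per-image volume.
[cite: Mochizuki2012, IUTchIII Thm. 3.11 (i) (Ind2) p. 154; Cor. 3.12 proof Step (x) p. 181] [cite: Mochizuki2012, IUTchIV Thm. 1.10 Step (v)
p. 27–28] [cite: DupuyHilado2025, §4.9, §4.11–4.12] [cite: WeilBNT1967, Ch. II §2, Th. 2] -/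
theorem thetaSlotLocal_settingPrVolSharp_eq_sum_orbitHull (ht0 : ∀ pp i x, t pp i x ≠ 0)
    (ht1 : ∀ (pp : Nat.Primes) (i : Fin X.lstar) (x : (thetaIndex X).Fibre (.inr pp)),
      haveI : Fact (pp : ℕ).Prime := ⟨pp.2⟩; placeOf X pp.1 x ∉ X.S → ‖t pp i x‖ = 1)
    (i : Fin (thetaIndex X).lstar) (pp : Nat.Primes) :
    haveI : Fact (pp : ℕ).Prime := ⟨pp.2⟩
    (settingPrVolSharp X hlog M archPk archSub Ψ act Mmod region n lat sig split qData tq t htq0 htq1).thetaSlotLocal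
        (Setting.labelSucc i) (.inr pp) =
      ((∑ e : (presAt X hlog pp).toLocalPieces.E (Setting.labelSucc i),
          weightPr X pp.1 (Setting.labelSucc i) e *
            packetLogμ pp.1 ((presAt X hlog pp).kk e)
              (packetHull pp.1 ((presAt X hlog pp).kk e)
                (⋃ g : indTwo pp.1 ((presAt X hlog pp).kk e),
                  g • iota pp.1 ((presAt X hlog pp).kk e) (Fin.last _) (t pp i (e (Fin.last _))) •
                    (normalizedPacket pp.1 ((presAt X hlog pp).kk e) : Set ((presAt X hlog pp).X e)))) : ℝ) :
        WithTop ℝ) := by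
  haveI : Fact (pp : ℕ).Prime := ⟨pp.2⟩
  -- the last-slot box at each tuple contains the non-zero vector `ι_{i+1}(t)`, so it has an exact content, chosen
  have hne : ∀ e : (thetaIndex X).Caps (Setting.labelSucc i) → (thetaIndex X).Fibre (.inr pp),
      ∃ x ∈ iota pp.1 ((presAt X hlog pp).kk e) (Fin.last _) (t pp i (e (Fin.last _))) •
          (normalizedPacket pp.1 ((presAt X hlog pp).kk e) : Set ((presAt X hlog pp).X e)), x ≠ 0 := by
    intro e
    refine ⟨iota pp.1 ((presAt X hlog pp).kk e) (Fin.last _) (t pp i (e (Fin.last _))), ?_,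
      (map_ne_zero (iota pp.1 ((presAt X hlog pp).kk e) (Fin.last _))).mpr (ht0 pp i _)⟩
    have h := Set.smul_mem_smul_set (a := iota pp.1 ((presAt X hlog pp).kk e) (Fin.last _) (t pp i (e (Fin.last _))))
      (Subring.one_mem (normalizedPacket pp.1 ((presAt X hlog pp).kk e)) : (1 : (presAt X hlog pp).X e) ∈
        (normalizedPacket pp.1 ((presAt X hlog pp).kk e) : Set ((presAt X hlog pp).X e)))
    rwa [smul_eq_mul, mul_one] at h
  have h := fun e : (thetaIndex X).Caps (Setting.labelSucc i) → (thetaIndex X).Fibre (.inr pp) =>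
    exists_content pp.1 ((presAt X hlog pp).kk e) (isPsiBounded_smul_normalizedPacket pp.1 ((presAt X hlog pp).kk e) _) (hne e)
  choose m hm0 hm1 using h
  rw [thetaSlotLocal_settingPrVolSharp_eq_sum_content_hull X hlog M archPk archSub Ψ act Mmod region n lat sig split qData t tq htq0 htq1
    ht0 ht1 i pp m hm0 hm1]
  congr 1
  refine Finset.sum_congr rfl fun e _ => ?_
  obtain ⟨x, hxM, hx⟩ := Set.not_subset.mp (hm1 e)
  rw [packetHull_orbit_eq_zpow pp.1 ((presAt X hlog pp).kk e) hxM hx (hm0 e),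
    packetLogμ_packetHull_zpow_smul_logPacket pp.1 ((presAt X hlog pp).kk e) (m e)]

end Summit.ABC.IUTFork.Thm311.Real
end
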